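import Summits.AtomisticToContinuum.Crystallization.Theses.FreeSplittingCertificates
import Literature.MathematicalPhysics.StatisticalMechanics.MuGroundStateConfiguration
import Summits.AtomisticToContinuum.Crystallization.Theorems.FreeSplittingCertificatesShellRigidityHcpStubCovering
import Summits.AtomisticToContinuum.Crystallization.Theorems.FreeSplittingCertificatesShellRigidityHcpStubNormFacts
import Summits.AtomisticToContinuum.Crystallization.Theorems.FreeSplittingCertificatesShellRigidityHcpStubLimitShell
import Summits.AtomisticToContinuum.Crystallization.Theorems.FreeSplittingCertificatesShellRigidityHcpStubWindowTransfer
import Summits.AtomisticToContinuum.Crystallization.Theorems.FreeSplittingCertificatesShellRigidityHcpStubEmptyZone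
import Summits.AtomisticToContinuum.Crystallization.Theorems.FreeSplittingCertificatesShellRigidityHcpStubMain
import Summits.AtomisticToContinuum.Crystallization.Theorems.FreeSplittingCertificatesShellRigidityHcpStubShellIdentification

/-!
# Skeleton (line `birth`, reshaped c2) — crux `FreeSplittingCertificates.ShellRigidityHcp`
# (stmt-AtomisticToContinuum-12561)

Route `route-AtomisticToContinuum-FreeSplittingCertificates`, sub-problem `Crystallization`.
Line `birth` (payload slug `registered`) = the route's own two-layer plan "exact stretched layer propagation
+ compactness upgrade", RESHAPED by the c2 lead into seven registered stubs after the discovery that the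
exact stretched layer propagation is ALREADY IN THE TREE off the ideal ratio:
`Summit.AtomisticToContinuum.Crystallization.Theorems.ExactHcpLocal.eq_image_hcpStacking`
(item `ExactHcpLocalTheorem` of route HullExactificationCascade, proved; envelope `0 < a`, `0 < h`,
`64/100 a² < h² < 69/100 a²`, which contains `h = (1+t)·a·√(2/3)` for `|t| ≤ 1/100`), and that the
compactness of `δ`-separated point sets in the local matching topology is the tree theorem
`Literature.MathematicalPhysics.StatisticalMechanics.exists_subseq_forall_eventually_ballMatch`.

Write `S(a,t) := hcpKissingPattern.image (u ↦ a • (u + (t (u₀+u₁+u₂)/3) • (1,1,1)))` (the stretched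
anticuboctahedral shell) and `h := (1+t)·a·√(2/3)`.

* `stub_covering` — 45° covering radius of the anticuboctahedron directions: for every linear isometry `A`
  and every `x`, some `u ∈ hcpKissingPattern` has `‖x‖ ≤ √2 ⟪x, A u⟫`.  (Inradius `1/√2` of the triangular
  orthobicupola; sign/ordering case split.)  Size S–M.
* `stub_normFacts` — the points of `S(a,t)` have norms in `(0.99a, 1.01a)` and are within `a/100` of the
  unstretched `a•u`.  Size S.
* `stub_shellIdentification` — a linear isometry `B` (the close-packing frame) carries `S(a,t)` onto the
  punctured `13/10 a`-cluster of the origin in `hcpStacking a h`.  Size M.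
* `stub_emptyZone` — [covering] → [normFacts] → in a finite configuration, if sites `k` and `j ≠ k` both have
  `η`-close first shells (`η ≤ a/100`) and `dist (x j) (x k) ≤ 4a/3`, then `dist (x j) (x k) ≤ 5a/4`
  (the zone `(5a/4, 4a/3]` about a constrained site contains no constrained site).  Size M.
* `stub_limitShell` — ONE-STEP limit lemma, no filters: if `Z` (a configuration, recentred) and `Y` (the limit)
  are `δ`-separated, `BallMatch ε (‖y‖+2a) 0 Z Y`, `p ∈ Z` is within `ε` of `y ∈ Y`, `p` has an `η`-close shell
  in `Z` w.r.t. a pattern `P` and an empty zone `(5a/4, 4a/3]`, then the punctured OPEN `13/10 a`-neighbourhood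
  of `y` in `Y` is in bijection with `P`, `(η + 2ε)`-close after a linear isometry.  Size M–L.
* `stub_windowTransfer` — reading a `BallMatch ε' R' 0 Z (g '' Λ)` with `0 ∈ g '' Λ` as the crux's two-sided
  window matching against `A (Λ − q)`, `q ∈ Λ`, `A` the linear part of `g`.  Size S–M.
* `stub_main` (the lead's) — the compactness upgrade proper: contradiction sequence, recentred ranges as
  `δ`-separated sets, extraction, `0 ∈ Y`, limit shells exact via `stub_limitShell` + `stub_emptyZone`,
  `ExactHcpLocal.eq_image_hcpStacking`, `stub_windowTransfer`, contradiction.  Size L.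

`ShellRigidityHcp_of : ShellRigidityHcp` composes them BY NAME with `P := hcpPeriodicConfiguration`
(`hcpPeriodicConfiguration_points`).

Disproof used: none on file for this crux (`ledger crux ls`: no `Disproof.lean`, 2026-08-17).
-/

noncomputable section

namespace Summit.AtomisticToContinuum.Crystallization.Cruxes.ShellRigidityHcp.Birth

open Literature.Geometry.DiscreteGeometry Literature.MathematicalPhysics.StatisticalMechanics

/-! ## Registered stubs (all seven LANDED under `Theorems/FreeSplittingCertificatesShellRigidityHcpStub*.lean`; no `sorry` left) -/

/-- **stub_covering** (45° covering radius of the anticuboctahedron): for every linear isometry `A` of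
`ℝ³` and every `x`, some vertex direction `A u`, `u ∈ hcpKissingPattern`, makes an angle `≤ 45°` with
`x`: `‖x‖ ≤ √2 ⟪x, A u⟫`. -/
theorem stub_covering :
    ∀ (A : EuclideanSpace ℝ (Fin 3) →ₗᵢ[ℝ] EuclideanSpace ℝ (Fin 3)) (x : EuclideanSpace ℝ (Fin 3)),
      ∃ u ∈ hcpKissingPattern, ‖x‖ ≤ Real.sqrt 2 * inner ℝ x (A u) :=
  Summit.AtomisticToContinuum.Crystallization.Theorems.ShellRigidityHcpBirth.stub_covering

/-- **stub_normFacts** (metric facts of the stretched shell `S(a,t)`, `|t| ≤ 1/100`): every stretched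
shell point has norm in `(0.99 a, 1.01 a)` (exactly `a` on the hexagon, `a√(1/3 + (2/3)(1+t)²)` on the
caps) and lies within `a/100` of its unstretched position `a • u` (displacement `a|t|√(2/3)`). -/
theorem stub_normFacts :
    ∀ a t : ℝ, 0 < a → |t| ≤ 1 / 100 →
      ∀ u ∈ hcpKissingPattern,
        99 / 100 * a < ‖a • (u + (t * (u 0 + u 1 + u 2) / 3) • intVec ![1, 1, 1])‖ ∧
        ‖a • (u + (t * (u 0 + u 1 + u 2) / 3) • intVec ![1, 1, 1])‖ < 101 / 100 * a ∧
        ‖a • (u + (t * (u 0 + u 1 + u 2) / 3) • intVec ![1, 1, 1]) - a • u‖ ≤ a / 100 :=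
  Summit.AtomisticToContinuum.Crystallization.Theorems.ShellRigidityHcpBirth.stub_normFacts

/-- **stub_shellIdentification** (the stretched shell IS the first shell of the stretched crystal): a
linear isometry `B` of `ℝ³` (the close-packing frame: hexagonal axis `(1,1,1)/√3 ↦ e₃`) carries `S(a,t)`
onto the punctured `13/10 a`-cluster of the origin in `hcpStacking a ((1+t)·a·√(2/3))` (six hexagon
sites at distance `a`, six cap sites at `√(a²/3 + h²)`; `ExactHcpLocal.norm_site_lt_iff`). -/
theorem stub_shellIdentification :
    ∀ a t : ℝ, 0 < a → |t| ≤ 1 / 100 →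
      ∃ B : EuclideanSpace ℝ (Fin 3) →ₗᵢ[ℝ] EuclideanSpace ℝ (Fin 3),
        (↑((hcpKissingPattern.image fun u =>
              a • (u + (t * (u 0 + u 1 + u 2) / 3) • intVec ![1, 1, 1])).image B) :
            Set (EuclideanSpace ℝ (Fin 3))) =
          {p : EuclideanSpace ℝ (Fin 3) |
            p ∈ hcpStacking a ((1 + t) * a * Real.sqrt (2 / 3)) ∧ p ≠ 0 ∧ ‖p‖ < 13 / 10 * a} :=
  Summit.AtomisticToContinuum.Crystallization.Theorems.ShellRigidityHcpBirth.stub_shellIdentification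

/-- **stub_emptyZone** (no constrained site in the zone `(5a/4, 4a/3]` about a constrained site): from
the covering and norm facts — in a finite configuration, if the first shells (radius `5a/4`) of `k` and of
`j ≠ k` are both `η`-close to `S(a,t)` with `η ≤ a/100` and `dist (x j) (x k) ≤ 4a/3`, then
`dist (x j) (x k) ≤ 5a/4`.  (Else a shell point `x m` of `k` lies within `0.955a + η` of `x j`, so
`x m - x j` is in `j`'s shell, whose points have norm `≥ 0.99a − η`: contradiction.) -/
theorem stub_emptyZone :
    (∀ (A : EuclideanSpace ℝ (Fin 3) →ₗᵢ[ℝ] EuclideanSpace ℝ (Fin 3)) (x : EuclideanSpace ℝ (Fin 3)),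
      ∃ u ∈ hcpKissingPattern, ‖x‖ ≤ Real.sqrt 2 * inner ℝ x (A u)) →
    (∀ a t : ℝ, 0 < a → |t| ≤ 1 / 100 →
      ∀ u ∈ hcpKissingPattern,
        99 / 100 * a < ‖a • (u + (t * (u 0 + u 1 + u 2) / 3) • intVec ![1, 1, 1])‖ ∧
        ‖a • (u + (t * (u 0 + u 1 + u 2) / 3) • intVec ![1, 1, 1])‖ < 101 / 100 * a ∧
        ‖a • (u + (t * (u 0 + u 1 + u 2) / 3) • intVec ![1, 1, 1]) - a • u‖ ≤ a / 100) →
    ∀ a t η : ℝ, 0 < a → |t| ≤ 1 / 100 → η ≤ a / 100 →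
      ∀ (N : ℕ) (x : Fin N → EuclideanSpace ℝ (Fin 3)) (k j : Fin N),
        ShellCloseTo η
          ((Finset.univ.filter fun l => l ≠ k ∧ dist (x l) (x k) ≤ 5 * a / 4).image fun l => x l - x k)
          (hcpKissingPattern.image fun u => a • (u + (t * (u 0 + u 1 + u 2) / 3) • intVec ![1, 1, 1])) →
        ShellCloseTo η
          ((Finset.univ.filter fun l => l ≠ j ∧ dist (x l) (x j) ≤ 5 * a / 4).image fun l => x l - x j)
          (hcpKissingPattern.image fun u => a • (u + (t * (u 0 + u 1 + u 2) / 3) • intVec ![1, 1, 1])) →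
        j ≠ k → dist (x j) (x k) ≤ 4 * a / 3 → dist (x j) (x k) ≤ 5 * a / 4 :=
  Summit.AtomisticToContinuum.Crystallization.Theorems.ShellRigidityHcpBirth.stub_emptyZone

/-- **stub_limitShell** (one step of the limit, no filters).  `Z` is a recentred configuration and `Y`
the limit set, both `δ`-separated; `Z` and `Y` are two-way `ε`-matched on the ball `‖·‖ ≤ ‖y‖ + 2a`;
`p ∈ Z` is within `ε` of `y ∈ Y`; the punctured closed `5a/4`-neighbourhood of `p` in `Z`, recentred, is
`η`-close to the pattern `P`, and `Z` has no point at distance in `(5a/4, 4a/3]` from `p`.  Then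
(`3ε ≤ δ`, `ε ≤ a/100`) the punctured OPEN `13/10 a`-neighbourhood of `y` in `Y` is in bijection with
`P`, `(η + 2ε)`-close after the same linear isometry: each such `z` has a unique particle `p_z ∈ Z` within
`ε`, `p_z - p` is a shell point (empty zone), matched to `A c`, `c ∈ P`; injective by separation,
surjective because every shell particle has a partner in `Y`. -/
theorem stub_limitShell :
    ∀ (a δ ε η : ℝ) (P : Finset (EuclideanSpace ℝ (Fin 3))) (Z Y : Set (EuclideanSpace ℝ (Fin 3)))
      (y p : EuclideanSpace ℝ (Fin 3)),
      0 < a → 0 < δ → 0 < ε → 3 * ε ≤ δ → ε ≤ a / 100 →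
      (∀ u ∈ Z, ∀ v ∈ Z, u ≠ v → δ ≤ dist u v) →
      (∀ u ∈ Y, ∀ v ∈ Y, u ≠ v → δ ≤ dist u v) →
      BallMatch ε (‖y‖ + 2 * a) 0 Z Y →
      y ∈ Y → p ∈ Z → dist p y ≤ ε →
      (∃ T : Finset (EuclideanSpace ℝ (Fin 3)),
        (↑T : Set (EuclideanSpace ℝ (Fin 3))) =
            (fun u => u - p) '' {u ∈ Z | u ≠ p ∧ dist u p ≤ 5 * a / 4} ∧
          ShellCloseTo η T P) →
      (∀ u ∈ Z, u ≠ p → dist u p ≤ 4 * a / 3 → dist u p ≤ 5 * a / 4) →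
      ∃ A : EuclideanSpace ℝ (Fin 3) →ₗᵢ[ℝ] EuclideanSpace ℝ (Fin 3),
        ∃ e : ↥{z : EuclideanSpace ℝ (Fin 3) | z ∈ Y ∧ z ≠ y ∧ dist z y < 13 / 10 * a} ≃ ↥P,
          ∀ z : ↥{z : EuclideanSpace ℝ (Fin 3) | z ∈ Y ∧ z ≠ y ∧ dist z y < 13 / 10 * a},
            dist ((z : EuclideanSpace ℝ (Fin 3)) - y) (A ((e z : ↥P) : EuclideanSpace ℝ (Fin 3))) ≤
              η + 2 * ε :=
  Summit.AtomisticToContinuum.Crystallization.Theorems.ShellRigidityHcpBirth.stub_limitShell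

/-- **stub_windowTransfer** (a ball matching against a rigid image of a point set is a two-sided window
matching against its linear part).  If `0 ∈ g '' Λ` for a Euclidean isometry `g` and `Z` is two-way
`ε'`-matched to `g '' Λ` on the ball `‖·‖ ≤ R'`, then with `q ∈ Λ`, `g q = 0`, and `A` the linear part of
`g` (`g x = A (x - q)`): every `p ∈ Λ` with `dist p q ≤ R'` has a `z ∈ Z` within `ε'` of `A (p - q)`, and
every `z ∈ Z` with `‖z‖ ≤ R'` is within `ε'` of some `A (p - q)`, `p ∈ Λ`. -/
theorem stub_windowTransfer :
    ∀ (Λ Z : Set (EuclideanSpace ℝ (Fin 3)))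
      (g : EuclideanSpace ℝ (Fin 3) ≃ᵢ EuclideanSpace ℝ (Fin 3)) (ε' R' : ℝ),
      (0 : EuclideanSpace ℝ (Fin 3)) ∈ g '' Λ → BallMatch ε' R' 0 Z (g '' Λ) →
      ∃ q ∈ Λ, ∃ A : EuclideanSpace ℝ (Fin 3) →ₗᵢ[ℝ] EuclideanSpace ℝ (Fin 3),
        (∀ p ∈ Λ, dist p q ≤ R' → ∃ z ∈ Z, dist z (A (p - q)) ≤ ε') ∧
        (∀ z ∈ Z, ‖z‖ ≤ R' → ∃ p ∈ Λ, dist z (A (p - q)) ≤ ε') :=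
  Summit.AtomisticToContinuum.Crystallization.Theorems.ShellRigidityHcpBirth.stub_windowTransfer

/-- **stub_main** (the compactness upgrade, the lead's stub).  At fixed `a, t` (`0 < a`, `|t| ≤ 1/100`),
from the shell identification, the empty-zone property, the one-step limit lemma and the window transfer:
for all `δ, R', ε' > 0` there are `η > 0` and `L` such that in every finite `δ`-separated configuration a
site all of whose neighbours within `L` have `η`-close first shells has its `R'`-window two-sidedly
`ε'`-matched to `x i + A (hcpStacking a ((1+t)a√(2/3)) − q)`.  Proof: contradiction sequence
`η_n = 1/(n+1)`, `L_n = n`; recentred ranges are `δ`-separated sets; local-matching compactness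
(`exists_subseq_forall_eventually_ballMatch`); `0` survives; limit shells are exact punctured
`13/10 a`-clusters (`stub_limitShell` fed by `stub_emptyZone`, then `stub_shellIdentification`);
`ExactHcpLocal.eq_image_hcpStacking` makes the limit a rigid image of the stretched crystal; the window
transfer of an eventual `BallMatch ε' R'` contradicts the choice of the sequence. -/
theorem stub_main :
    ∀ a t : ℝ, 0 < a → |t| ≤ 1 / 100 →
      (∃ B : EuclideanSpace ℝ (Fin 3) →ₗᵢ[ℝ] EuclideanSpace ℝ (Fin 3),
        (↑((hcpKissingPattern.image fun u =>
              a • (u + (t * (u 0 + u 1 + u 2) / 3) • intVec ![1, 1, 1])).image B) :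
            Set (EuclideanSpace ℝ (Fin 3))) =
          {p : EuclideanSpace ℝ (Fin 3) |
            p ∈ hcpStacking a ((1 + t) * a * Real.sqrt (2 / 3)) ∧ p ≠ 0 ∧ ‖p‖ < 13 / 10 * a}) →
      (∀ η : ℝ, η ≤ a / 100 →
        ∀ (N : ℕ) (x : Fin N → EuclideanSpace ℝ (Fin 3)) (k j : Fin N),
          ShellCloseTo η
            ((Finset.univ.filter fun l => l ≠ k ∧ dist (x l) (x k) ≤ 5 * a / 4).image fun l => x l - x k)
            (hcpKissingPattern.image fun u => a • (u + (t * (u 0 + u 1 + u 2) / 3) • intVec ![1, 1, 1])) →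
          ShellCloseTo η
            ((Finset.univ.filter fun l => l ≠ j ∧ dist (x l) (x j) ≤ 5 * a / 4).image fun l => x l - x j)
            (hcpKissingPattern.image fun u => a • (u + (t * (u 0 + u 1 + u 2) / 3) • intVec ![1, 1, 1])) →
          j ≠ k → dist (x j) (x k) ≤ 4 * a / 3 → dist (x j) (x k) ≤ 5 * a / 4) →
      (∀ (a δ ε η : ℝ) (P : Finset (EuclideanSpace ℝ (Fin 3))) (Z Y : Set (EuclideanSpace ℝ (Fin 3)))
        (y p : EuclideanSpace ℝ (Fin 3)),
        0 < a → 0 < δ → 0 < ε → 3 * ε ≤ δ → ε ≤ a / 100 →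
        (∀ u ∈ Z, ∀ v ∈ Z, u ≠ v → δ ≤ dist u v) →
        (∀ u ∈ Y, ∀ v ∈ Y, u ≠ v → δ ≤ dist u v) →
        BallMatch ε (‖y‖ + 2 * a) 0 Z Y →
        y ∈ Y → p ∈ Z → dist p y ≤ ε →
        (∃ T : Finset (EuclideanSpace ℝ (Fin 3)),
          (↑T : Set (EuclideanSpace ℝ (Fin 3))) =
              (fun u => u - p) '' {u ∈ Z | u ≠ p ∧ dist u p ≤ 5 * a / 4} ∧
            ShellCloseTo η T P) →
        (∀ u ∈ Z, u ≠ p → dist u p ≤ 4 * a / 3 → dist u p ≤ 5 * a / 4) →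
        ∃ A : EuclideanSpace ℝ (Fin 3) →ₗᵢ[ℝ] EuclideanSpace ℝ (Fin 3),
          ∃ e : ↥{z : EuclideanSpace ℝ (Fin 3) | z ∈ Y ∧ z ≠ y ∧ dist z y < 13 / 10 * a} ≃ ↥P,
            ∀ z : ↥{z : EuclideanSpace ℝ (Fin 3) | z ∈ Y ∧ z ≠ y ∧ dist z y < 13 / 10 * a},
              dist ((z : EuclideanSpace ℝ (Fin 3)) - y) (A ((e z : ↥P) : EuclideanSpace ℝ (Fin 3))) ≤
                η + 2 * ε) →
      (∀ (Λ Z : Set (EuclideanSpace ℝ (Fin 3)))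
        (g : EuclideanSpace ℝ (Fin 3) ≃ᵢ EuclideanSpace ℝ (Fin 3)) (ε' R' : ℝ),
        (0 : EuclideanSpace ℝ (Fin 3)) ∈ g '' Λ → BallMatch ε' R' 0 Z (g '' Λ) →
        ∃ q ∈ Λ, ∃ A : EuclideanSpace ℝ (Fin 3) →ₗᵢ[ℝ] EuclideanSpace ℝ (Fin 3),
          (∀ p ∈ Λ, dist p q ≤ R' → ∃ z ∈ Z, dist z (A (p - q)) ≤ ε') ∧
          (∀ z ∈ Z, ‖z‖ ≤ R' → ∃ p ∈ Λ, dist z (A (p - q)) ≤ ε')) →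
      ∀ δ R' ε' : ℝ, 0 < δ → 0 < R' → 0 < ε' → ∃ η : ℝ, 0 < η ∧ ∃ L : ℝ,
        ∀ (N : ℕ) (x : Fin N → EuclideanSpace ℝ (Fin 3)),
          (∀ i j, i ≠ j → δ ≤ dist (x i) (x j)) →
          ∀ i : Fin N,
            (∀ k : Fin N, dist (x k) (x i) ≤ L →
              ShellCloseTo η
                ((Finset.univ.filter fun j => j ≠ k ∧ dist (x j) (x k) ≤ 5 * a / 4).image
                  fun j => x j - x k)
                (hcpKissingPattern.image fun u =>
                  a • (u + (t * (u 0 + u 1 + u 2) / 3) • intVec ![1, 1, 1]))) →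
            ∃ q ∈ hcpStacking a ((1 + t) * a * Real.sqrt (2 / 3)),
              ∃ A : EuclideanSpace ℝ (Fin 3) →ₗᵢ[ℝ] EuclideanSpace ℝ (Fin 3),
                (∀ p ∈ hcpStacking a ((1 + t) * a * Real.sqrt (2 / 3)), dist p q ≤ R' →
                  ∃ j, dist (x j) (x i + A (p - q)) ≤ ε') ∧
                (∀ j, dist (x j) (x i) ≤ R' →
                  ∃ p ∈ hcpStacking a ((1 + t) * a * Real.sqrt (2 / 3)),
                    dist (x j) (x i + A (p - q)) ≤ ε') :=
  Summit.AtomisticToContinuum.Crystallization.Theorems.ShellRigidityHcpBirth.stub_main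

/-! ## Composition (kernel-checked, no `sorry` outside the stubs it names) -/

/-- **The crux from the seven stubs, by name.**  `P := hcpPeriodicConfiguration` with in-layer spacing
`a` and layer spacing `(1+t)·a·√(2/3)` (nonzero since `|t| ≤ 1/100 < 1`); its point set is the
stretched hcp stacking (`hcpPeriodicConfiguration_points`), so `stub_main` fed with
`stub_shellIdentification`, `stub_emptyZone stub_covering stub_normFacts`, `stub_limitShell` and
`stub_windowTransfer` is exactly the body of `ShellRigidityHcp` at `(a,t)`. -/
theorem ShellRigidityHcp_of :
    Summit.AtomisticToContinuum.Crystallization.Theses.FreeSplittingCertificates.ShellRigidityHcp := by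
  intro a t ha ht
  have h1t : (0 : ℝ) < 1 + t := by
    have := (abs_le.mp ht).1
    linarith
  have hh : (1 + t) * a * Real.sqrt (2 / 3) ≠ 0 :=
    (mul_pos (mul_pos h1t ha) (Real.sqrt_pos.mpr (by norm_num))).ne'
  refine ⟨hcpPeriodicConfiguration ha.ne' hh, ?_⟩
  intro δ R' ε' hδ hR' hε'
  obtain ⟨η, hη, L, hL⟩ :=
    stub_main a t ha ht (stub_shellIdentification a t ha ht)
      (fun η hη => stub_emptyZone stub_covering stub_normFacts a t η ha ht hη)
      stub_limitShell stub_windowTransfer δ R' ε' hδ hR' hε'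
  refine ⟨η, hη, L, ?_⟩
  intro N x hsep i hshell
  rw [hcpPeriodicConfiguration_points]
  exact hL N x hsep i hshell

end Summit.AtomisticToContinuum.Crystallization.Cruxes.ShellRigidityHcp.Birth
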